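import Mathlib.NumberTheory.NumberField.Cyclotomic.Galois
import Mathlib.NumberTheory.DirichletCharacter.Orthogonality
import Mathlib.RingTheory.RootsOfUnity.Complex
import Mathlib.RingTheory.RootsOfUnity.AlgebraicallyClosed
import Mathlib.RingTheory.Polynomial.Cyclotomic.Basic
import Mathlib.Analysis.Complex.Polynomial.Basic

/-!
# Dirichlet characters of an intermediate field of `ℚ(ζ_m)`: the character product lemma

Route `PlecticLegs`, support item `ArtinBaseChange` (stmt-BirchSwinnertonDyer-18261). Let
`K = ℚ(ζ_m)`, `H ≤ Gal(K/ℚ)` and `Y = Y_H` the group of Dirichlet characters mod `m` trivial on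
`H` (Mathlib's `IsCyclotomicExtension.Rat.subgroupGalEquivSubgroupChar m K ℂ H`, Washington Ch. 3:
`Y_H` is the character group of `Gal(F/ℚ)`, `F = K^H`). For a unit `u` mod `m` with
`σ_u ∈ Gal(K/ℚ)` (`σ_u(ζ) = ζ^u`) of order `n` in `Gal(K/ℚ)/H`:

* `apply_eq_one_of_mem_subgroupChar`: the root-of-unity form of "`χ` is trivial on `H`" used by
  the route statement;
* `prod_one_sub_apply_mul_eq_of_subgroupChar`: the **character product lemma**
  `∏_{χ ∈ Y_H} (1 - χ(u) T) = (1 - T^n)^{#Y_H / n}` (`χ ↦ χ(u)` maps `Y_H` onto the `n`-th roots of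
  unity with fibres of equal size) — the character side of Artin formalism at a prime `p ∤ m`
  (`u = p`, `n = f(w|p)` the residue degree in `F`), generalising the tree's
  `DirichletCharacter.prod_one_sub_apply_mul` (`H = 1`, Fröhlich–Taylor Thm. 47).

## References

* L. C. Washington, *Introduction to Cyclotomic Fields*, GTM 83, Ch. 3 and Thm. 4.3.
* A. Fröhlich, M. J. Taylor, *Algebraic Number Theory*, CUP 1991, VI §2 Thm. 47.
-/

noncomputable section

-- D-0017: single-problem summit, so `Summit.BirchSwinnertonDyer.BirchSwinnertonDyer.…` repeats a
-- namespace BY DESIGN.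
set_option linter.dupNamespace false

open scoped Classical
open Finset IsCyclotomicExtension.Rat

namespace Summit.BirchSwinnertonDyer.BirchSwinnertonDyer.Theorems

variable (m : ℕ) [NeZero m] (K : Type) [Field K] [NumberField K] [IsCyclotomicExtension {m} ℚ K]
  [IsMulCommutative Gal(K/ℚ)]

omit [IsMulCommutative Gal(K/ℚ)] in
/-- A Dirichlet character mod `m` trivial on `H ≤ Gal(ℚ(ζ_m)/ℚ)` (`χ(a_σ) = 1` for `σ ∈ H`,
`σ(ζ) = ζ^{a_σ}`) satisfies the root-of-unity form of triviality used by the route statement: if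
`σ ∈ H` acts on all `m`-th roots of unity by `z ↦ z^a` then `χ(a) = 1`. [folklore] -/
theorem apply_eq_one_of_mem_subgroupChar {H : Subgroup Gal(K/ℚ)} {χ : DirichletCharacter ℂ m}
    (hχ : χ ∈ (subgroupGalEquivSubgroupChar m K ℂ H).ofDual) {σ : Gal(K/ℚ)} (hσ : σ ∈ H) {a : ℕ}
    (ha : ∀ z : K, z ^ m = 1 → σ z = z ^ a) : χ (a : ZMod m) = 1 := by
  rw [mem_subgroupGalEquivSubgroupChar_iff] at hχ
  have hζ := IsCyclotomicExtension.zeta_spec m ℚ K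
  set u := galEquivZMod m K σ with hu
  have h1 : σ (IsCyclotomicExtension.zeta m ℚ K) = (IsCyclotomicExtension.zeta m ℚ K) ^ a :=
    ha _ hζ.pow_eq_one
  have h2 := galEquivZMod_apply_of_pow_eq m K σ hζ.pow_eq_one
  rw [h1] at h2
  rw [(hζ.isOfFinOrder (NeZero.ne m)).pow_inj_mod, ← hζ.eq_orderOf] at h2
  have h3 : (a : ZMod m) = ((u : (ZMod m)ˣ) : ZMod m) := by
    rw [← ZMod.natCast_zmod_val ((u : (ZMod m)ˣ) : ZMod m)]
    exact (ZMod.natCast_eq_natCast_iff' a _ m).mpr h2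
  rw [h3]
  exact hχ σ hσ

/-- `#Y_H = #(Gal(K/ℚ)/H)` (duality for finite abelian groups; Washington Ch. 3), the finset
form of Mathlib's `card_subgroupGalEquivSubgroupChar`. [folklore] -/
theorem card_filter_mem_subgroupChar (H : Subgroup Gal(K/ℚ)) :
    #(univ.filter fun χ : DirichletCharacter ℂ m ↦ χ ∈ (subgroupGalEquivSubgroupChar m K ℂ H).ofDual) =
      Nat.card (Gal(K/ℚ) ⧸ H) := by
  rw [← card_subgroupGalEquivSubgroupChar m K ℂ H, Nat.card_eq_fintype_card, ← Fintype.card_coe]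
  refine Fintype.card_congr (Equiv.subtypeEquivRight fun χ ↦ ?_)
  simp

/-- **Character product lemma for `Y_H`.** Let `u` be a unit mod `m`, `σ_u ∈ Gal(ℚ(ζ_m)/ℚ)` the
automorphism `ζ ↦ ζ^u` and `n` the order of `σ_u H` in `Gal(ℚ(ζ_m)/ℚ)/H`. Then
`∏_{χ ∈ Y_H} (1 - χ(u) T) = (1 - T^n)^{#(Gal/H) / n}` and `n ∣ #(Gal/H)`: the homomorphism
`χ ↦ χ(u)` maps `Y_H ≅ (Gal/H)^∨` onto the `n`-th roots of unity — its image has order `n` because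
`Y_H^⊥ = H` — with fibres of equal size, and `∏_{ζ^n = 1} (1 - ζT) = 1 - T^n`. With `u = p ∤ m` this
is "each `f`-th root of unity is taken equally often as a value of `χ(p)`, `χ` a character of
`Gal(F/ℚ)`" (Fröhlich–Taylor, proof of Thm. 47; Washington, proof of Thm. 4.3). [folklore] -/
theorem prod_one_sub_apply_mul_eq_of_subgroupChar (H : Subgroup Gal(K/ℚ)) (u : (ZMod m)ˣ) (T : ℂ) :
    ∏ χ ∈ univ.filter (fun χ : DirichletCharacter ℂ m ↦
        χ ∈ (subgroupGalEquivSubgroupChar m K ℂ H).ofDual), (1 - χ u * T) =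
      (1 - T ^ orderOf (QuotientGroup.mk ((galEquivZMod m K).symm u) : Gal(K/ℚ) ⧸ H)) ^
        (Nat.card (Gal(K/ℚ) ⧸ H) /
          orderOf (QuotientGroup.mk ((galEquivZMod m K).symm u) : Gal(K/ℚ) ⧸ H)) := by
  set Y : Subgroup (DirichletCharacter ℂ m) := (subgroupGalEquivSubgroupChar m K ℂ H).ofDual with hY
  set σu : Gal(K/ℚ) := (galEquivZMod m K).symm u with hσu
  set n := orderOf (QuotientGroup.mk σu : Gal(K/ℚ) ⧸ H) with hn
  have hu : galEquivZMod m K σu = u := by rw [hσu, MulEquiv.apply_symm_apply]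
  -- membership in `Y` and in `H = Y^⊥`
  have hmemY : ∀ χ : DirichletCharacter ℂ m, χ ∈ Y ↔ ∀ σ ∈ H, χ (galEquivZMod m K σ) = 1 :=
    fun χ ↦ mem_subgroupGalEquivSubgroupChar_iff m K ℂ χ H
  have hmemH : ∀ σ : Gal(K/ℚ), σ ∈ H ↔ ∀ χ ∈ Y, χ (galEquivZMod m K σ) = 1 := by
    intro σ
    have h := mem_subgroupGalEquivSubgroupChar_symm_iff m K ℂ σ Y
    rw [hY, OrderDual.toDual_ofDual, OrderIso.symm_apply_apply] at h
    exact h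
  -- the evaluation homomorphism on `Y`
  set φ : Y →* ℂˣ := (MonoidHom.eval u).comp
    ((MulChar.mulEquivToUnitHom (R := ZMod m) (R' := ℂ)).toMonoidHom.comp Y.subtype) with hφ
  have hφval : ∀ y : Y, (φ y : ℂ) = (y : DirichletCharacter ℂ m) u := by
    intro y
    simp [hφ, MulChar.mulEquivToUnitHom_apply, MulChar.coe_equivToUnitHom]
  have hφpow : ∀ (y : Y) (k : ℕ), φ y ^ k = 1 ↔ (y : DirichletCharacter ℂ m) (u ^ k : (ZMod m)ˣ) = 1 := by
    intro y k
    rw [Units.ext_iff, Units.val_pow_eq_pow_val, hφval, Units.val_one, ← map_pow,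
      Units.val_pow_eq_pow_val]
  -- (1) every value `χ(u)`, `χ ∈ Y`, is an `n`-th root of unity
  have hσun : σu ^ n ∈ H := by
    rw [← QuotientGroup.eq_one_iff, QuotientGroup.mk_pow, hn]
    exact pow_orderOf_eq_one _
  have hrange_le : φ.range ≤ rootsOfUnity n ℂ := by
    rintro _ ⟨y, rfl⟩
    haveI : NeZero n := ⟨(orderOf_pos _).ne'⟩
    rw [mem_rootsOfUnity, hφpow]
    have h := (hmemY y).mp y.2 (σu ^ n) hσun
    rwa [map_pow, hu] at h
  -- (2) the range has order `n`
  set d := Nat.card φ.range with hd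
  have hdvd1 : d ∣ n := by
    haveI : NeZero n := ⟨(orderOf_pos _).ne'⟩
    rw [hd, ← Complex.card_rootsOfUnity n]
    exact Subgroup.card_dvd_of_le hrange_le
  have hdvd2 : n ∣ d := by
    rw [hn]
    refine orderOf_dvd_of_pow_eq_one ?_
    rw [← QuotientGroup.mk_pow, QuotientGroup.eq_one_iff, hmemH]
    intro χ hχ
    rw [map_pow, hu]
    have h : φ ⟨χ, hχ⟩ ^ d = 1 := by
      have h' : (⟨φ ⟨χ, hχ⟩, ⟨χ, hχ⟩, rfl⟩ : φ.range) ^ d = 1 := pow_card_eq_one'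
      rwa [Subtype.ext_iff, Subgroup.coe_pow] at h'
    exact (hφpow ⟨χ, hχ⟩ d).mp h
  have hdn : d = n := Nat.dvd_antisymm hdvd1 hdvd2
  have hnpos : 0 < n := orderOf_pos _
  -- (3) rewrite the product over `Y` and group it along the fibres of `φ`
  have hprod : ∏ χ ∈ univ.filter (fun χ : DirichletCharacter ℂ m ↦ χ ∈ Y), (1 - χ u * T) =
      ∏ y : Y, (fun x : ℂˣ ↦ 1 - (x : ℂ) * T) (φ y) := by
    rw [Finset.prod_subtype (univ.filter fun χ : DirichletCharacter ℂ m ↦ χ ∈ Y) (p := (· ∈ Y))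
      (fun χ ↦ by simp)]
    exact Finset.prod_congr rfl fun y _ ↦ by simp only [hφval]
  rw [hprod, Finset.prod_comp (f := fun x : ℂˣ ↦ 1 - (x : ℂ) * T) (g := φ)]
  set c := #{y : Y | φ y = 1} with hc
  have hfib : ∀ x ∈ univ.image φ, #{y ∈ (univ : Finset Y) | φ y = x} = c := by
    intro x hx
    have hx' : x ∈ Set.range φ := by
      obtain ⟨y, -, rfl⟩ := Finset.mem_image.mp hx
      exact ⟨y, rfl⟩
    rw [MonoidHom.card_fiber_eq_of_mem_range φ hx' ⟨1, map_one φ⟩, hc]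
  rw [Finset.prod_congr rfl fun x hx ↦ by rw [hfib x hx], Finset.prod_pow]
  -- (4) the image of `φ` as a finset is the set of `n`-th roots of unity, and `#Y = n c`
  have hcard_img : (univ.image φ).card = d := by
    have e : φ.range ≃ {x // x ∈ univ.image φ} :=
      Equiv.subtypeEquivRight fun x ↦ by simp [MonoidHom.mem_range]
    rw [hd, Nat.card_congr e, Nat.card_eq_fintype_card, Fintype.card_coe]
  have htot : Nat.card (Gal(K/ℚ) ⧸ H) = d * c := by
    rw [← card_subgroupGalEquivSubgroupChar m K ℂ H, ← hY, Nat.card_eq_fintype_card,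
      ← Finset.card_univ, Finset.card_eq_sum_card_image φ univ, Finset.sum_congr rfl hfib,
      sum_const, smul_eq_mul, hcard_img]
  have hc' : Nat.card (Gal(K/ℚ) ⧸ H) / n = c := by
    rw [htot, hdn, Nat.mul_div_cancel_left _ hnpos]
  rw [hc']
  congr 1
  have hsub : (univ.image φ).image (Units.val : ℂˣ → ℂ) ⊆ Polynomial.nthRootsFinset n (1 : ℂ) := by
    intro z hz
    obtain ⟨x, hx, rfl⟩ := Finset.mem_image.mp hz
    obtain ⟨y, -, rfl⟩ := Finset.mem_image.mp hx
    haveI : NeZero n := ⟨hnpos.ne'⟩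
    rw [Polynomial.mem_nthRootsFinset hnpos, ← Units.val_pow_eq_pow_val]
    have h := hrange_le ⟨y, rfl⟩
    rw [mem_rootsOfUnity] at h
    rw [h, Units.val_one]
  have heq : (univ.image φ).image (Units.val : ℂˣ → ℂ) = Polynomial.nthRootsFinset n (1 : ℂ) := by
    refine Finset.eq_of_subset_of_card_le hsub ?_
    rw [(Complex.isPrimitiveRoot_exp n hnpos.ne').card_nthRootsFinset,
      Finset.card_image_of_injective _ Units.val_injective, hcard_img, hdn]
  rw [← Finset.prod_image (s := univ.image φ) (g := (Units.val : ℂˣ → ℂ))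
    (f := fun z : ℂ ↦ 1 - z * T) Units.val_injective.injOn, heq,
    ← (Complex.isPrimitiveRoot_exp n hnpos.ne').pow_sub_pow_eq_prod_sub_mul 1 T hnpos, one_pow]

/-- The order `n` of `σ_u H` divides `#(Gal(K/ℚ)/H)` (Lagrange). [folklore] -/
theorem orderOf_mk_galEquivZMod_symm_dvd (H : Subgroup Gal(K/ℚ)) (u : (ZMod m)ˣ) :
    orderOf (QuotientGroup.mk ((galEquivZMod m K).symm u) : Gal(K/ℚ) ⧸ H) ∣
      Nat.card (Gal(K/ℚ) ⧸ H) :=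
  orderOf_dvd_natCard _

end Summit.BirchSwinnertonDyer.BirchSwinnertonDyer.Theorems

end
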